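import Mathlib
import HarnessLib
import Literature.NumberTheory.LFunctions.ZetaScrew
import Summits.RiemannHypothesis.RiemannHypothesis.Theorems.IntegerScrewIncrementBrackets

/-!
# Route `IntegerScrew` — SHARPNESS of the `K`-node floors: no predictor from `K` lags gains more than
# `(S_K + o(1))/log M` (PIVOT-LAW §15.3; RH-FREE, no pivot, no definiteness hypothesis)

`IntegerScrewKNodeFloor` shows that the trial vector `I_M − (1/log M)Σ_{k≤K}(c_k/2) I_{M−k}` gains
`(S_K − o(1))/log M` over the one-node energy `W_0 = M·2Ψ(h_M)`.  Here the converse for LOCAL predictors: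
for EVERY choice of increment coefficients `t_1, …, t_K` (`t_0 = 1`),
`(W_0 − M·‖I_M + Σ_{k≤K} t_k I_{M−k}‖²)·log M ≤ S_K + ε` eventually in `M`, uniformly in `t`
(`eventually_kNode_gain_le`).  So the `K` nearest increments are worth EXACTLY `S_K/log M·(1 + o(1))`
of prediction gain: the constants `S_K ↑ V/2 = ¼Σ_{k≥1}(Δ²[k log k])²` of PIVOT-LAW §15 are the exact
local gains, and everything beyond them in the deficit `G(M)` is long-memory (PIVOT-LAW §2a(iv), §8).
Proof: a Gershgorin lower bound for the increment Gram matrix `Γ_{jk} = M·B_M(j,k)` (diagonal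
`∼ log M`, off-diagonal entries convergent) and completing the square coordinatewise.  The same
bound gives `eventually_incrementGram_ge_half_log`: the Gram matrix of the `K+1` increments nearest the
corner dominates `½·log M·I` for large `M` — RH-FREE local positivity («a failure of RH is never local»).  Statements about
`Ψ` on `[0, log 2)` only; nothing here bears on the truth of RH. [Suzuki2023, (1.1)]
-/

noncomputable section

-- D-0017: `Summit.<S>.<S>.…` is the designed namespace of a single-problem summit.
set_option linter.dupNamespace false

namespace Summit.RiemannHypothesis.RiemannHypothesis.Theorems.IntegerScrew

open Literature.NumberTheory.LFunctions Filter Finset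
open scoped Topology

/-! ### Two elementary quadratic-form facts -/

/-- GERSHGORIN-TYPE LOWER BOUND for a symmetric kernel on `range K`:
`Σ_{j,k} u_j u_k Γ(j,k) ≥ Σ_k (Γ(k,k) − R_k)·u_k²`, `R_k = Σ_{j ≠ k} |Γ(j,k)|`. [folklore] -/
theorem sum_sum_mul_ge_diag_sub_offdiag (K : ℕ) (u : ℕ → ℝ) (Γ : ℕ → ℕ → ℝ)
    (hsym : ∀ j k, Γ j k = Γ k j) :
    ∑ k ∈ range K, (Γ k k - ∑ j ∈ range K, (if j = k then 0 else |Γ j k|)) * u k ^ 2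
      ≤ ∑ j ∈ range K, ∑ k ∈ range K, u j * u k * Γ j k := by
  -- termwise bound
  have hterm : ∀ j k : ℕ, (if j = k then Γ k k * u k ^ 2 else 0)
      - (if j = k then 0 else |Γ j k|) * (u j ^ 2 + u k ^ 2) / 2 ≤ u j * u k * Γ j k := by
    intro j k
    by_cases hjk : j = k
    · subst hjk; simp; ring_nf; rfl
    · simp only [hjk, if_false, zero_sub]
      have h2 : 2 * (|u j| * |u k|) ≤ u j ^ 2 + u k ^ 2 := by
        have := two_mul_le_add_sq (|u j|) (|u k|)
        simp only [sq_abs] at this; linarith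
      have h3 : -(|Γ j k| * (|u j| * |u k|)) ≤ u j * u k * Γ j k := by
        have : |u j * u k * Γ j k| = |Γ j k| * (|u j| * |u k|) := by
          rw [abs_mul, abs_mul]; ring
        rw [← this]; exact neg_abs_le _
      have h4 : |Γ j k| * (u j ^ 2 + u k ^ 2) / 2 ≥ |Γ j k| * (|u j| * |u k|) := by
        have := mul_le_mul_of_nonneg_left h2 (abs_nonneg (Γ j k)); linarith
      linarith
  have hsum := Finset.sum_le_sum fun j (_ : j ∈ range K) =>
    Finset.sum_le_sum fun k (_ : k ∈ range K) => hterm j k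
  refine le_trans (le_of_eq ?_) hsum
  -- evaluate the bound: Σ_j Σ_k [diag] − Σ_j Σ_k [offdiag]·(u_j² + u_k²)/2
  simp only [Finset.sum_sub_distrib]
  rw [show (∑ j ∈ range K, ∑ k ∈ range K, (if j = k then Γ k k * u k ^ 2 else (0 : ℝ)))
      = ∑ k ∈ range K, Γ k k * u k ^ 2 by
    refine Finset.sum_congr rfl fun j hj => ?_
    rw [Finset.sum_ite_eq (range K) j (fun k => Γ k k * u k ^ 2)]
    simp [hj]]
  have hoff : ∑ j ∈ range K, ∑ k ∈ range K, (if j = k then 0 else |Γ j k|) * (u j ^ 2 + u k ^ 2) / 2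
      = ∑ k ∈ range K, (∑ j ∈ range K, (if j = k then 0 else |Γ j k|)) * u k ^ 2 := by
    have hsplit : ∀ j k : ℕ, (if j = k then 0 else |Γ j k|) * (u j ^ 2 + u k ^ 2) / 2
        = (if j = k then 0 else |Γ j k|) * u j ^ 2 / 2 + (if j = k then 0 else |Γ j k|) * u k ^ 2 / 2 := by
      intro j k; ring
    simp only [hsplit, Finset.sum_add_distrib]
    -- the first double sum equals the second after swapping j ↔ k (symmetry of |Γ|)
    have hswap : ∑ j ∈ range K, ∑ k ∈ range K, (if j = k then 0 else |Γ j k|) * u j ^ 2 / 2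
        = ∑ j ∈ range K, ∑ k ∈ range K, (if j = k then 0 else |Γ j k|) * u k ^ 2 / 2 := by
      rw [Finset.sum_comm]
      refine Finset.sum_congr rfl fun k _ => Finset.sum_congr rfl fun j _ => ?_
      by_cases h : j = k
      · subst h; simp
      · rw [if_neg h, if_neg (Ne.symm h), hsym j k]
    rw [hswap, ← Finset.sum_add_distrib]
    simp_rw [← Finset.sum_add_distrib]
    rw [Finset.sum_comm]
    refine Finset.sum_congr rfl fun k _ => ?_
    rw [Finset.sum_mul]
    exact Finset.sum_congr rfl fun j _ => by ring
  rw [hoff, ← Finset.sum_sub_distrib]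
  exact Finset.sum_congr rfl fun k _ => by ring

/-- COMPLETING THE SQUARE: for `λ > 0`, `−2uc − λu² ≤ c²/λ`. [folklore] -/
theorem neg_two_mul_sub_mul_sq_le {lam : ℝ} (hlam : 0 < lam) (u c : ℝ) :
    -(2 * u * c) - lam * u ^ 2 ≤ c ^ 2 / lam := by
  rw [le_div_iff₀ hlam]
  nlinarith [sq_nonneg (c + lam * u)]

/-! ### The sharpness theorem -/

/-- Peeling the first row/column of the `(K+1)×(K+1)` increment form with `σ(1) = 1` and a symmetric
kernel: `β(0,0) − Σ_{j,k≤K} σ(j+1)σ(k+1)β(j,k) = −(2Σ_{k<K} σ(k+2)β(0,k+1) + Σ_{j,k<K} σ(j+2)σ(k+2)β(j+1,k+1))`.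
[folklore] -/
private theorem peel_gain (K : ℕ) (β : ℕ → ℕ → ℝ) (σ : ℕ → ℝ) (hσ1 : σ 1 = 1)
    (hsym : ∀ j, β (j + 1) 0 = β 0 (j + 1)) :
    β 0 0 - ∑ j ∈ range (K + 1), ∑ k ∈ range (K + 1), σ (j + 1) * σ (k + 1) * β j k
      = -(2 * ∑ k ∈ range K, σ (k + 1 + 1) * β 0 (k + 1)
          + ∑ j ∈ range K, ∑ k ∈ range K, σ (j + 1 + 1) * σ (k + 1 + 1) * β (j + 1) (k + 1)) := by
  simp only [Finset.sum_range_succ', zero_add, hσ1, one_mul, mul_one, Finset.sum_add_distrib]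
  rw [Finset.sum_congr rfl fun j _ => show σ (j + 1 + 1) * β (j + 1) 0 = σ (j + 1 + 1) * β 0 (j + 1) by
    rw [hsym j]]
  ring

/-- **NO `K`-LAG PREDICTOR GAINS MORE THAN `(S_K + ε)/log M`.**  For every `K` and `ε > 0`, eventually
in `M`, for ALL increment coefficients `σ` with `σ(1) = 1` (`t_k = σ(k+1)`, `t_0 = 1`):
`(M·B_M(0,0) − M·Σ_{j,k≤K} σ(j+1)σ(k+1)·B_M(j,k))·log M ≤ S_K + ε`, i.e.
`(W_0 − M·‖I_M + Σ_{k=1}^{K} t_k I_{M−k}‖²)·log M ≤ S_K + ε` with `S_K = Σ_{k=1}^{K}(c_k/2)²` — the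
`K`-node floor constant of `IntegerScrewKNodeFloor` is the exact local gain. [folklore] -/
theorem eventually_kNode_gain_le (K : ℕ) (ε : ℝ) (hε : 0 < ε) :
    ∀ᶠ M : ℕ in atTop, ∀ σ : ℕ → ℝ, σ 1 = 1 →
      ((M : ℝ) * (zetaScrew (Real.log ((M : ℝ) - ((0 : ℕ) : ℝ)) - Real.log ((M : ℝ) - (((0 : ℕ) : ℝ) + 1)))
        + zetaScrew (Real.log ((M : ℝ) - (((0 : ℕ) : ℝ) + 1)) - Real.log ((M : ℝ) - ((0 : ℕ) : ℝ)))
        - zetaScrew (Real.log ((M : ℝ) - ((0 : ℕ) : ℝ)) - Real.log ((M : ℝ) - ((0 : ℕ) : ℝ)))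
        - zetaScrew (Real.log ((M : ℝ) - (((0 : ℕ) : ℝ) + 1)) - Real.log ((M : ℝ) - (((0 : ℕ) : ℝ) + 1))))
        - (M : ℝ) * ∑ j ∈ range (K + 1), ∑ k ∈ range (K + 1), σ (j + 1) * σ (k + 1) * (zetaScrew (Real.log ((M : ℝ) - (j : ℝ)) - Real.log ((M : ℝ) - ((k : ℝ) + 1)))
        + zetaScrew (Real.log ((M : ℝ) - ((j : ℝ) + 1)) - Real.log ((M : ℝ) - (k : ℝ)))
        - zetaScrew (Real.log ((M : ℝ) - (j : ℝ)) - Real.log ((M : ℝ) - (k : ℝ)))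
        - zetaScrew (Real.log ((M : ℝ) - ((j : ℝ) + 1)) - Real.log ((M : ℝ) - ((k : ℝ) + 1)))))
        * Real.log (M : ℝ) ≤ (∑ k ∈ Finset.Icc 1 K, (-((((k : ℕ) : ℝ) + 1) * Real.log (((k : ℕ) : ℝ) + 1) - 2 * ((((k : ℕ) : ℝ)) * Real.log ((k : ℕ) : ℝ))
            + ((((k : ℕ) : ℝ)) - 1) * Real.log ((((k : ℕ) : ℝ)) - 1)) / 2) ^ 2) + ε := by
  set s : ℕ → ℝ := fun k => (-((((k : ℕ) : ℝ) + 1) * Real.log (((k : ℕ) : ℝ) + 1) - 2 * ((((k : ℕ) : ℝ)) * Real.log ((k : ℕ) : ℝ))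
            + ((((k : ℕ) : ℝ)) - 1) * Real.log ((((k : ℕ) : ℝ)) - 1)) / 2) with hs
  set β : ℕ → ℕ → ℕ → ℝ := fun M j k => (zetaScrew (Real.log ((M : ℝ) - (j : ℝ)) - Real.log ((M : ℝ) - ((k : ℝ) + 1)))
        + zetaScrew (Real.log ((M : ℝ) - ((j : ℝ) + 1)) - Real.log ((M : ℝ) - (k : ℝ)))
        - zetaScrew (Real.log ((M : ℝ) - (j : ℝ)) - Real.log ((M : ℝ) - (k : ℝ)))
        - zetaScrew (Real.log ((M : ℝ) - ((j : ℝ) + 1)) - Real.log ((M : ℝ) - ((k : ℝ) + 1)))) with hβ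
  have hlog : Tendsto (fun M : ℕ => Real.log (M : ℝ)) atTop atTop :=
    Real.tendsto_log_atTop.comp tendsto_natCast_atTop_atTop
  -- symmetry of the brackets
  have hβsym : ∀ M : ℕ, ∀ j k : ℕ, β M j k = β M k j := by
    intro M j k; simp only [hβ]; rw [incrementBracket_comm (M : ℝ) (j : ℝ) (k : ℝ)]
  -- limits: row 0, diagonal, off-diagonal
  have hrow : ∀ k : ℕ, Tendsto (fun M : ℕ => (M : ℝ) * β M 0 (k + 1)) atTop (𝓝 (s (k + 1))) := by
    intro k
    have h := tendsto_mul_incrementBracket (j := 0) (k := k + 1) (by omega)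
    simp only [hβ, hs] at h ⊢
    exact h
  have hdiag : ∀ k : ℕ, Tendsto (fun M : ℕ => (M : ℝ) * β M (k + 1) (k + 1) / Real.log (M : ℝ))
      atTop (𝓝 1) := by
    intro k; simp only [hβ]; exact tendsto_mul_incrementBracket_diag_div_log (k + 1)
  have hoffd : ∀ j k : ℕ, j ≠ k → Tendsto (fun M : ℕ =>
      |(M : ℝ) * β M (j + 1) (k + 1)| / Real.log (M : ℝ)) atTop (𝓝 0) := by
    intro j k hjk
    have h := (tendsto_mul_incrementBracket_div_log (j := j + 1) (k := k + 1) (by omega)).abs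
    simp only [hβ, abs_zero] at h ⊢
    refine h.congr' ?_
    filter_upwards [eventually_gt_atTop 1] with M hM
    have hL : 0 < Real.log (M : ℝ) := Real.log_pos (by exact_mod_cast hM)
    rw [abs_div, abs_of_pos hL]
  -- the Gershgorin margins (Γ_kk − R_k)/log M → 1 and the bound Σ_k C_k²·log M/(Γ_kk − R_k) → S_K
  have hR : ∀ k : ℕ, Tendsto (fun M : ℕ => (∑ j ∈ range K,
      (if j = k then 0 else |(M : ℝ) * β M (j + 1) (k + 1)|)) / Real.log (M : ℝ)) atTop (𝓝 0) := by
    intro k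
    have : Tendsto (fun M : ℕ => ∑ j ∈ range K,
        (if j = k then 0 else |(M : ℝ) * β M (j + 1) (k + 1)|) / Real.log (M : ℝ)) atTop
        (𝓝 (∑ j ∈ range K, (0 : ℝ))) := by
      refine tendsto_finsetSum _ fun j _ => ?_
      by_cases hjk : j = k
      · subst hjk; simp
      · simp only [hjk, if_false]; exact hoffd j k hjk
    rw [Finset.sum_const_zero] at this
    refine this.congr fun M => ?_
    rw [Finset.sum_div]
  have hmargin : ∀ k : ℕ, Tendsto (fun M : ℕ => ((M : ℝ) * β M (k + 1) (k + 1)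
      - ∑ j ∈ range K, (if j = k then 0 else |(M : ℝ) * β M (j + 1) (k + 1)|)) / Real.log (M : ℝ))
      atTop (𝓝 1) := by
    intro k
    have := (hdiag k).sub (hR k)
    rw [sub_zero] at this
    refine this.congr fun M => ?_
    rw [sub_div]
  have hbound : Tendsto (fun M : ℕ => ∑ k ∈ range K, ((M : ℝ) * β M 0 (k + 1)) ^ 2 *
      (Real.log (M : ℝ) / ((M : ℝ) * β M (k + 1) (k + 1)
        - ∑ j ∈ range K, (if j = k then 0 else |(M : ℝ) * β M (j + 1) (k + 1)|)))) atTop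
      (𝓝 (∑ k ∈ range K, s (k + 1) ^ 2 * 1)) := by
    refine tendsto_finsetSum _ fun k _ => ((hrow k).pow 2).mul ?_
    have h := (hmargin k).inv₀ one_ne_zero
    rw [inv_one] at h
    refine h.congr fun M => ?_
    rw [inv_div]
  have hval : ∑ k ∈ range K, s (k + 1) ^ 2 * 1 = ∑ k ∈ Finset.Icc 1 K, s k ^ 2 := by
    simp only [mul_one]
    rw [show Finset.Icc 1 K = Finset.Ico 1 (K + 1) from rfl, Finset.sum_Ico_eq_sum_range,
      Nat.add_sub_cancel]
    exact Finset.sum_congr rfl fun k _ => by rw [add_comm 1 k]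
  rw [hval] at hbound
  -- eventually: all margins positive, and the bound ≤ S_K + ε
  have hpos : ∀ k : ℕ, ∀ᶠ M : ℕ in atTop, 0 < (M : ℝ) * β M (k + 1) (k + 1)
      - ∑ j ∈ range K, (if j = k then 0 else |(M : ℝ) * β M (j + 1) (k + 1)|) := by
    intro k
    have h1 := (hmargin k).eventually (lt_mem_nhds (by norm_num : (1 : ℝ) / 2 < 1))
    filter_upwards [h1, eventually_gt_atTop 1] with M hM hM1
    have hL : 0 < Real.log (M : ℝ) := Real.log_pos (by exact_mod_cast hM1)
    by_contra hneg
    push Not at hneg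
    have : ((M : ℝ) * β M (k + 1) (k + 1)
        - ∑ j ∈ range K, (if j = k then 0 else |(M : ℝ) * β M (j + 1) (k + 1)|)) / Real.log (M : ℝ) ≤ 0 :=
      div_nonpos_of_nonpos_of_nonneg hneg hL.le
    linarith
  have hallpos : ∀ᶠ M : ℕ in atTop, ∀ k ∈ range K, 0 < (M : ℝ) * β M (k + 1) (k + 1)
      - ∑ j ∈ range K, (if j = k then 0 else |(M : ℝ) * β M (j + 1) (k + 1)|) :=
    (Finset.eventually_all (range K)).2 fun k _ => hpos k
  filter_upwards [hallpos, hbound.eventually (gt_mem_nhds (lt_add_of_pos_right _ hε)),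
    eventually_gt_atTop 1] with M hposM hbM hM1 σ hσ1
  have hL : 0 < Real.log (M : ℝ) := Real.log_pos (by exact_mod_cast hM1)
  -- names
  set Cb : ℕ → ℝ := fun k => (M : ℝ) * β M 0 (k + 1) with hCb
  set Γ : ℕ → ℕ → ℝ := fun j k => (M : ℝ) * β M (j + 1) (k + 1) with hΓ
  set u : ℕ → ℝ := fun k => σ (k + 1 + 1) with hu
  have hΓsym : ∀ j k, Γ j k = Γ k j := fun j k => by simp only [hΓ]; rw [hβsym M (j + 1) (k + 1)]
  -- peel: the gain is −(2Σ u_k Cb_k + Σ u_j u_k Γ_jk)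
  have hpeel := peel_gain K (β M) σ hσ1 (fun j => hβsym M (j + 1) 0)
  have hgain : (M : ℝ) * β M 0 0
      - (M : ℝ) * ∑ j ∈ range (K + 1), ∑ k ∈ range (K + 1), σ (j + 1) * σ (k + 1) * β M j k
      = -(2 * ∑ k ∈ range K, u k * Cb k + ∑ j ∈ range K, ∑ k ∈ range K, u j * u k * Γ j k) := by
    have hA : (M : ℝ) * ∑ k ∈ range K, σ (k + 1 + 1) * β M 0 (k + 1) = ∑ k ∈ range K, u k * Cb k := by
      rw [Finset.mul_sum]
      exact Finset.sum_congr rfl fun k _ => by simp only [hu, hCb]; ring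
    have hB : (M : ℝ) * ∑ j ∈ range K, ∑ k ∈ range K, σ (j + 1 + 1) * σ (k + 1 + 1) * β M (j + 1) (k + 1)
        = ∑ j ∈ range K, ∑ k ∈ range K, u j * u k * Γ j k := by
      rw [Finset.mul_sum]
      refine Finset.sum_congr rfl fun j _ => ?_
      rw [Finset.mul_sum]
      exact Finset.sum_congr rfl fun k _ => by simp only [hu, hΓ]; ring
    rw [← mul_sub, hpeel, ← hA, ← hB]
    ring
  -- Gershgorin + completing the square: gain ≤ Σ_k Cb_k²/(Γ_kk − R_k)
  have hG := sum_sum_mul_ge_diag_sub_offdiag K u Γ hΓsym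
  have hsq : -(2 * ∑ k ∈ range K, u k * Cb k + ∑ j ∈ range K, ∑ k ∈ range K, u j * u k * Γ j k)
      ≤ ∑ k ∈ range K, Cb k ^ 2 / (Γ k k - ∑ j ∈ range K, (if j = k then 0 else |Γ j k|)) := by
    have h1 : -(2 * ∑ k ∈ range K, u k * Cb k + ∑ j ∈ range K, ∑ k ∈ range K, u j * u k * Γ j k)
        ≤ ∑ k ∈ range K, (-(2 * u k * Cb k)
          - (Γ k k - ∑ j ∈ range K, (if j = k then 0 else |Γ j k|)) * u k ^ 2) := by
      rw [Finset.sum_sub_distrib, Finset.mul_sum]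
      have : ∑ k ∈ range K, -(2 * u k * Cb k) = -∑ k ∈ range K, 2 * (u k * Cb k) := by
        rw [← Finset.sum_neg_distrib]; exact Finset.sum_congr rfl fun k _ => by ring
      rw [this]
      linarith
    refine h1.trans (Finset.sum_le_sum fun k hk => ?_)
    have hposk := hposM k hk
    exact neg_two_mul_sub_mul_sq_le hposk (u k) (Cb k)
  -- the bound times log M, and its value
  have hfinal : (∑ k ∈ range K, Cb k ^ 2 / (Γ k k - ∑ j ∈ range K, (if j = k then 0 else |Γ j k|)))
      * Real.log (M : ℝ)
      = ∑ k ∈ range K, ((M : ℝ) * β M 0 (k + 1)) ^ 2 *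
        (Real.log (M : ℝ) / ((M : ℝ) * β M (k + 1) (k + 1)
          - ∑ j ∈ range K, (if j = k then 0 else |(M : ℝ) * β M (j + 1) (k + 1)|))) := by
    rw [Finset.sum_mul]
    exact Finset.sum_congr rfl fun k _ => by simp only [hCb, hΓ]; ring
  rw [hgain]
  calc -(2 * ∑ k ∈ range K, u k * Cb k + ∑ j ∈ range K, ∑ k ∈ range K, u j * u k * Γ j k)
        * Real.log (M : ℝ)
      ≤ (∑ k ∈ range K, Cb k ^ 2 / (Γ k k - ∑ j ∈ range K, (if j = k then 0 else |Γ j k|)))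
          * Real.log (M : ℝ) := mul_le_mul_of_nonneg_right hsq hL.le
    _ = _ := hfinal
    _ ≤ _ := hbM.le

/-! ### RH cannot fail locally: the corner blocks of the increment Gram matrix dominate `½·log M` -/

/-- **LOCAL POSITIVITY (RH-FREE).**  For every `K`, eventually in `M`, the Gram matrix of the `K + 1`
increments nearest the corner dominates `½ log M` times the identity:
`½·log M·Σ_{k≤K} u_k² ≤ Σ_{j,k≤K} u_j u_k·(M·B_M(j,k))` for ALL real `u`.  (RH ⇔ every finite Gram matrix
of increments of the screw line is positive semidefinite; the ones built from a bounded number of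
consecutive increments at the corner are positive definite unconditionally for `M ≥ M₀(K)` — a failure of
RH is never local.) [folklore] -/
theorem eventually_incrementGram_ge_half_log (K : ℕ) :
    ∀ᶠ M : ℕ in atTop, ∀ u : ℕ → ℝ,
      (1 / 2) * Real.log (M : ℝ) * ∑ k ∈ range (K + 1), u k ^ 2 ≤
        ∑ j ∈ range (K + 1), ∑ k ∈ range (K + 1), u j * u k * ((M : ℝ) * (zetaScrew (Real.log ((M : ℝ) - (j : ℝ)) - Real.log ((M : ℝ) - ((k : ℝ) + 1)))
        + zetaScrew (Real.log ((M : ℝ) - ((j : ℝ) + 1)) - Real.log ((M : ℝ) - (k : ℝ)))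
        - zetaScrew (Real.log ((M : ℝ) - (j : ℝ)) - Real.log ((M : ℝ) - (k : ℝ)))
        - zetaScrew (Real.log ((M : ℝ) - ((j : ℝ) + 1)) - Real.log ((M : ℝ) - ((k : ℝ) + 1))))) := by
  set β : ℕ → ℕ → ℕ → ℝ := fun M j k => (zetaScrew (Real.log ((M : ℝ) - (j : ℝ)) - Real.log ((M : ℝ) - ((k : ℝ) + 1)))
        + zetaScrew (Real.log ((M : ℝ) - ((j : ℝ) + 1)) - Real.log ((M : ℝ) - (k : ℝ)))
        - zetaScrew (Real.log ((M : ℝ) - (j : ℝ)) - Real.log ((M : ℝ) - (k : ℝ)))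
        - zetaScrew (Real.log ((M : ℝ) - ((j : ℝ) + 1)) - Real.log ((M : ℝ) - ((k : ℝ) + 1)))) with hβ
  have hβsym : ∀ M : ℕ, ∀ j k : ℕ, β M j k = β M k j := by
    intro M j k; simp only [hβ]; rw [incrementBracket_comm (M : ℝ) (j : ℝ) (k : ℝ)]
  -- margins: (M·B(k,k) − Σ_{j≠k}|M·B(j,k)|)/log M → 1 for every k
  have hdiag : ∀ k : ℕ, Tendsto (fun M : ℕ => (M : ℝ) * β M k k / Real.log (M : ℝ)) atTop (𝓝 1) := by
    intro k; simp only [hβ]; exact tendsto_mul_incrementBracket_diag_div_log k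
  have hoffd : ∀ j k : ℕ, j ≠ k → Tendsto (fun M : ℕ =>
      |(M : ℝ) * β M j k| / Real.log (M : ℝ)) atTop (𝓝 0) := by
    intro j k hjk
    have h := (tendsto_mul_incrementBracket_div_log (j := j) (k := k) hjk).abs
    simp only [hβ, abs_zero] at h ⊢
    refine h.congr' ?_
    filter_upwards [eventually_gt_atTop 1] with M hM
    have hL : 0 < Real.log (M : ℝ) := Real.log_pos (by exact_mod_cast hM)
    rw [abs_div, abs_of_pos hL]
  have hmargin : ∀ k : ℕ, Tendsto (fun M : ℕ => ((M : ℝ) * β M k k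
      - ∑ j ∈ range (K + 1), (if j = k then 0 else |(M : ℝ) * β M j k|)) / Real.log (M : ℝ))
      atTop (𝓝 1) := by
    intro k
    have hR : Tendsto (fun M : ℕ => ∑ j ∈ range (K + 1),
        (if j = k then 0 else |(M : ℝ) * β M j k|) / Real.log (M : ℝ)) atTop
        (𝓝 (∑ j ∈ range (K + 1), (0 : ℝ))) := by
      refine tendsto_finsetSum _ fun j _ => ?_
      by_cases hjk : j = k
      · subst hjk; simp
      · simp only [hjk, if_false]; exact hoffd j k hjk
    rw [Finset.sum_const_zero] at hR
    have := (hdiag k).sub hR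
    rw [sub_zero] at this
    refine this.congr fun M => ?_
    rw [sub_div, Finset.sum_div]
  have hhalf : ∀ k : ℕ, ∀ᶠ M : ℕ in atTop, (1 / 2) * Real.log (M : ℝ) ≤ (M : ℝ) * β M k k
      - ∑ j ∈ range (K + 1), (if j = k then 0 else |(M : ℝ) * β M j k|) := by
    intro k
    filter_upwards [(hmargin k).eventually (lt_mem_nhds (by norm_num : (1 : ℝ) / 2 < 1)),
      eventually_gt_atTop 1] with M hM hM1
    have hL : 0 < Real.log (M : ℝ) := Real.log_pos (by exact_mod_cast hM1)
    have := (lt_div_iff₀ hL).1 hM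
    linarith
  filter_upwards [(Finset.eventually_all (range (K + 1))).2 fun k _ => hhalf k] with M hM u
  have hG := sum_sum_mul_ge_diag_sub_offdiag (K + 1) u (fun j k => (M : ℝ) * β M j k)
    (fun j k => by rw [hβsym M j k])
  refine le_trans ?_ (hG.trans (le_of_eq (Finset.sum_congr rfl fun j _ =>
    Finset.sum_congr rfl fun k _ => by simp only [hβ])))
  rw [Finset.mul_sum]
  exact Finset.sum_le_sum fun k hk => mul_le_mul_of_nonneg_right (hM k hk) (sq_nonneg _)

end Summit.RiemannHypothesis.RiemannHypothesis.Theorems.IntegerScrew
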